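import Summits.QuantumFields.BalabanUV.T4Continuum.Support.NE7EJTorusAlias
import Summits.QuantumFields.BalabanUV.T4Continuum.Support.NE7EJFlatDefectLattice

/-!
# NE7EJFlatBloch — row NE7 (node U5), candidate route HOM, variant H1L-EJ, item EJ-1b′ (T1)–(T3′): LENS 1's FLAT SHARP MASTER INEQUALITY
# «EF^flat ≥ ⅛Hess_f²(4 − Hess_f)» IN KERNEL ON EVERY EVEN TORUS — for every 1-form `w` on `(ℤ∕2N)²`, with Bałaban's L = 2 cells,
# `⟨w, (½Hess² − ⅛Hess³)w⟩ ≤ EF^flat(w)` (file 122's `EFflat 2 blkB`), `Hess = CᵀC` the flat Hessian on 1-forms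

Lineage `b2b-balaban-t4-ne7-p2` (CRUX PROVER NE7 #2 = C-HOM°'s kernel hand), generation 81; file 125 (sequel of 124 `NE7EJTorusAlias` and 122
`NE7EJFlatDefectLattice`; end of the chain 117 → 118 → 123 → 124 → 125 ← 119 ← 122).

SOURCE (lens 1 = `t4-ne7-idea-1`, ROUTES-NE7 ▶v3.164 (i)): «FLAT, SHARP — NOW A THEOREM [paper + exact rational arithmetic] … S_φ ≤ 1 at EVERY momentum
with equality iff p is on an axis ⇒ EF^flat ≥ ⅛Hess_f²(4 − Hess_f) on phys ON EVERY TORUS, equality exactly on the axis alias blocks»; gen 67 NOTE §1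
(A1)–(A2) 9e7cf2b6f8adbc99 (transport `C φ(C†C) = φ(CC†) C`, `EF^flat = C†(1 − 4A†A)C`).  THIS FILE assembles the kernel chain (the real forms `lapR ∕ gKR ∕ avgR` and **`master_real`** are file 124's §4): §2 the adjoint curl `curlT`,
**`dF_curlT`** (`CCᵀ = K`), **`sum_mul_curlT`** (summation by parts `⟨w, CᵀG⟩ = ⟨Cw, G⟩`), `hess = CᵀC`, `phiHessForm` (`⟨w, (½Hess² − ⅛Hess³)w⟩`),
**`phiHessForm_eq`** (the transport to plaquette fields); §3 docking to file 122 at L = 2: **`sum_fib_two`** (Bałaban's cell of `P` = `{ιP + u : u ∈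
{0,1}²}`), `sqFlux_two`, **`dcQ_two`** (`d_cQ = ¼·avgR`), **`EFflat_two_eq`** (`EF^flat = Σ|dw|² − (1∕64)Σ_P avgR(dw)²`); §4 **`flat_master_oneforms`**.
«On phys»: both sides vanish on `ker C` (file 119 `phi_mulVec_eq_zero ∕ EF_mulVec_eq_zero`), so the statement on all 1-forms is the one on phys.
§5 BAŁABAN's (48) ON THE TORUS for the LINEARISED average (42) with B5 (1.7) tree contours (last piece reversed as in (14)), d = 2, L = 2:
`treeSum ∕ straightSum ∕ Qlin` (`Qlin_const`: `Q̂(0) = L = 2`), `dcQlin` (its coarse curl), **`dcQlin_eq`** (`d_c(Q^{lin}w)(y) = ¼Σ_{r,v∈{0,1}²}(dw)(y+r+v)`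
at EVERY base point — corner cancellation + Stokes, a linear identity), **`dcQlin_corner`** (= file 122's `dcQ`, which was DEFINED by (48)'s right side),
**`EFflat_eq_linear`** (`EF^flat = Σ|dw|² − ¼Σ_P(d_c(Q^{lin}w)(ιP))²` — lens 1's `EF := Hess_f − ¼Q†Hess_cQ` with Bałaban's linearised Q, literally) and
**`flat_master_linear`**.  [Balaban1985Averaging] (14) p. 19, (42) p. 23, (48) p. 25 (kernel on `ℤ^d`: `B7Prop1Explicit.corner_cancellation` + `stokes`);
[Balaban1984PropagatorsI] (1.7) p. 18.

HONEST FRAMING: [folklore]; a d = 2, L = 2 FLAT ABELIAN TOY RUNG of lens 1's («never the NE7 estimate»); `EF^flat` is file 122's object (its `d_cQ`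
DEFINED by the right side of B7 (48)); the theorem is for even tori `(ℤ∕2N)²` (L = 2 needs an even side) and for `φ = ⅛x²(4 − x)` only (the Padé
`φ_a` of the curved architecture is not polynomial and not covered); nothing curved, nothing d = 4, nothing of Bałaban's instantiated; NOT a letter
move (PRICING-NE7 v50); T-50-10 honoured.  NE7 NOT PRINTED ∕ NOT PROVED; spine 0∕9; FIXED FINITE T⁴, rung (B)+1; NOT infinite volume, NOT mass gap,
NOT Clay.  HONEST DEPENDENCY: continuum YM on T⁴ ⇐ BetaPertH ∧ nine spine estimates (0/9 proved); BetaPertH ⇐ (D1) ∧ (D4) ∧ CAP+tail; G-an2-4 gates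
asym, D1 and NE2/3/4.
-/

noncomputable section

open Finset Complex ZMod

namespace Summit.QuantumFields.BalabanUV.T4Continuum.NE7EJFlatBloch

open NE7EJTorusFourier NE7EJTorusAlias NE7EJFlatSecular NE7EJSecularCriterion NE7EJFlatTransport NE7EJFlatDefectLattice
/-! ### The 1-form level: `EF^flat ≥ ½Hess² − ⅛Hess³ = ⅛Hess²(4 − Hess)` on every even torus -/

section OneForms

variable (N : ℕ) [NeZero N]

omit [NeZero N] in
/-- file 122's unit vectors are `e₀, e₁`. [folklore] -/
theorem ev_eq : (ev 0 : XX (2 * N)) = e0 ∧ (ev 1 : XX (2 * N)) = e1 := by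
  unfold ev e0 e1; simp

/-- the ADJOINT CURL `Cᵀ` (plaquette fields → 1-forms): `(CᵀG)(x,0) = G(x) − G(x − e₁)`, `(CᵀG)(x,1) = G(x − e₀) − G(x)`. [folklore] -/
def curlT (G : XX (2 * N) → ℝ) (x : XX (2 * N)) (μ : Fin 2) : ℝ := if μ = 0 then G x - G (x + -e1) else G (x + -e0) - G x

omit [NeZero N] in
/-- `C Cᵀ = K`: the curl of the adjoint curl is the plaquette Laplacian. [folklore] -/
theorem dF_curlT (G : XX (2 * N) → ℝ) (x : XX (2 * N)) : dF (curlT N G) x = lapR N G x := by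
  unfold dF curlT lapR
  rw [(ev_eq N).1, (ev_eq N).2]
  simp only [if_true, show (1 : Fin 2) ≠ 0 from one_ne_zero, if_false, add_neg_cancel_right]
  ring

/-- **summation by parts on the torus**: `⟨w, CᵀG⟩ = ⟨Cw, G⟩`. [folklore] -/
theorem sum_mul_curlT (w : XX (2 * N) → Fin 2 → ℝ) (G : XX (2 * N) → ℝ) :
    ∑ x, ∑ μ : Fin 2, w x μ * curlT N G x μ = ∑ x, dF w x * G x := by
  simp only [Fin.sum_univ_two, curlT, if_true, show (1 : Fin 2) ≠ 0 from one_ne_zero, if_false, dF]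
  rw [(ev_eq N).1, (ev_eq N).2]
  -- reindex the shifted sums
  have s1 : ∑ x : XX (2 * N), w x 0 * G (x + -e1) = ∑ x : XX (2 * N), w (x + e1) 0 * G x :=
    Fintype.sum_equiv (Equiv.addRight (-e1)) _ _ fun x => by simp
  have s0 : ∑ x : XX (2 * N), w x 1 * G (x + -e0) = ∑ x : XX (2 * N), w (x + e0) 1 * G x :=
    Fintype.sum_equiv (Equiv.addRight (-e0)) _ _ fun x => by simp
  simp only [mul_sub, sum_add_distrib, sum_sub_distrib, s1, s0]
  rw [← sum_sub_distrib, ← sum_sub_distrib, ← sum_add_distrib]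
  refine (sum_congr rfl fun x _ => ?_)
  ring

/-- the flat Hessian on 1-forms: `Hess = CᵀC`. [folklore] -/
def hess (w : XX (2 * N) → Fin 2 → ℝ) : XX (2 * N) → Fin 2 → ℝ := curlT N (dF w)

/-- the quadratic form of `φ(Hess) = ½Hess² − ⅛Hess³ = ⅛Hess²(4 − Hess)`. [folklore] -/
def phiHessForm (w : XX (2 * N) → Fin 2 → ℝ) : ℝ :=
  ∑ x, ∑ μ : Fin 2, w x μ * ((1 / 2) * hess N (hess N w) x μ - (1 / 8) * hess N (hess N (hess N w)) x μ)

/-- transport to plaquette fields: `⟨w, φ(Hess)w⟩ = ⟨F, (½K − ⅛K²)F⟩`, `F = dw`. [folklore] -/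
theorem phiHessForm_eq (w : XX (2 * N) → Fin 2 → ℝ) :
    phiHessForm N w = ∑ x, dF w x * ((1 / 2) * lapR N (dF w) x - (1 / 8) * lapR N (lapR N (dF w)) x) := by
  have key : ∀ v : XX (2 * N) → Fin 2 → ℝ, ∑ x, ∑ μ : Fin 2, w x μ * hess N v x μ = ∑ x, dF w x * dF v x :=
    fun v => sum_mul_curlT N w (dF v)
  have hK : ∀ G : XX (2 * N) → ℝ, dF (curlT N G) = lapR N G := fun G => funext fun x => dF_curlT N G x
  have h2 : dF (hess N w) = lapR N (dF w) := hK _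
  have h3 : dF (hess N (hess N w)) = lapR N (lapR N (dF w)) := by
    show dF (curlT N (dF (hess N w))) = _
    rw [hK, h2]
  unfold phiHessForm
  have e : ∀ x (μ : Fin 2), w x μ * ((1 / 2) * hess N (hess N w) x μ - (1 / 8) * hess N (hess N (hess N w)) x μ)
      = (1 / 2) * (w x μ * hess N (hess N w) x μ) - (1 / 8) * (w x μ * hess N (hess N (hess N w)) x μ) := fun x μ => by ring
  simp only [e, sum_sub_distrib, ← mul_sum]
  rw [key, key, h2, h3, mul_sum, mul_sum, ← sum_sub_distrib]
  exact sum_congr rfl fun x _ => by ring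

/-! ### Docking to file 122 at L = 2 -/

/-- the `L = 2` cell of `P` consists of `corner P + u`, `u ∈ {0,1}²`: sums over it. [folklore] -/
theorem sum_fib_two (P : Fin N × Fin N) (f : XX (2 * N) → ℝ) :
    ∑ x ∈ fib (blkB 2 N) P, f x = ∑ u : Bool × Bool, f (corner N P + offB N u) := by
  have hval : ∀ (k : Fin N) (b : Bool), (dbl N k + (if b then (1 : ZMod (2 * N)) else 0)).val = 2 * k + (if b then 1 else 0) := by
    intro k b
    have hk := k.isLt
    unfold dbl
    cases b
    · simp only [Bool.false_eq_true, if_false, add_zero, ZMod.val_natCast]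
      rw [Nat.mod_eq_of_lt (by omega)]
    · simp only [if_true]
      rw [show ((2 * (k : ℕ) : ℕ) : ZMod (2 * N)) + 1 = ((2 * (k : ℕ) + 1 : ℕ) : ZMod (2 * N)) by push_cast; ring,
        ZMod.val_natCast, Nat.mod_eq_of_lt (by omega)]
  refine (sum_bij' (fun u _ => corner N P + offB N u) (fun x _ => (decide (x.1.val % 2 = 1), decide (x.2.val % 2 = 1)))
    ?_ ?_ ?_ ?_ ?_).symm
  · -- the image lies in the cell
    intro u _
    simp only [fib, blkB, mem_filter, mem_univ, true_and, Prod.ext_iff, Fin.ext_iff]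
    simp only [corner, offB, Prod.fst_add, Prod.snd_add, hval]
    constructor <;> (split_ifs <;> omega)
  · intro x _; exact mem_univ _
  · -- labels are recovered
    intro u _
    obtain ⟨u₁, u₂⟩ := u
    simp only [corner, offB, Prod.fst_add, Prod.snd_add, hval, Prod.mk.injEq]
    constructor
    · cases u₁
      · exact decide_eq_false (by rw [if_neg Bool.false_ne_true]; omega)
      · exact decide_eq_true (by rw [if_pos rfl]; omega)
    · cases u₂
      · exact decide_eq_false (by rw [if_neg Bool.false_ne_true]; omega)
      · exact decide_eq_true (by rw [if_pos rfl]; omega)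
  · -- cell points are recovered
    intro x hx
    simp only [fib, blkB, mem_filter, mem_univ, true_and, Prod.ext_iff, Fin.ext_iff] at hx
    obtain ⟨h1, h2⟩ := hx
    have d1 := Nat.div_add_mod x.1.val 2
    have d2 := Nat.div_add_mod x.2.val 2
    refine Prod.ext ?_ ?_
    · apply ZMod.val_injective
      simp only [corner, offB, Prod.fst_add, hval]
      rw [← h1]
      by_cases hb : x.1.val % 2 = 1
      · rw [decide_eq_true hb, if_pos rfl]; omega
      · rw [decide_eq_false hb, if_neg Bool.false_ne_true]; omega
    · apply ZMod.val_injective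
      simp only [corner, offB, Prod.snd_add, hval]
      rw [← h2]
      by_cases hb : x.2.val % 2 = 1
      · rw [decide_eq_true hb, if_pos rfl]; omega
      · rw [decide_eq_false hb, if_neg Bool.false_ne_true]; omega
  · intro u _; rfl

omit [NeZero N] in
/-- the `2 × 2` square flux is the sum over the offsets `{0,1}²`. [folklore] -/
theorem sqFlux_two (F : XX (2 * N) → ℝ) (x : XX (2 * N)) : sqFlux 2 F x = ∑ v : Bool × Bool, F (x + offB N v) := by
  unfold sqFlux off offB
  rw [Fin.sum_univ_two, Fin.sum_univ_two, Fin.sum_univ_two, Fintype.sum_prod_type]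
  simp only [Fintype.sum_bool, Fin.val_zero, Fin.val_one, Nat.cast_zero, Nat.cast_one, if_true, Bool.false_eq_true, if_false]
  ring

/-- **file 122's `d_cQ` at L = 2 is a quarter of the 16-fold tent sum**: `dcQ 2 blkB F P = ¼·avgR F P`. [folklore] -/
theorem dcQ_two (F : XX (2 * N) → ℝ) (P : Fin N × Fin N) : dcQ 2 (blkB 2 N) F P = (1 / 4) * avgR N F P := by
  unfold dcQ avgR
  rw [sum_fib_two]
  simp_rw [sqFlux_two]
  norm_num

/-- hence `EF^flat(w) = Σ|dw|² − (1∕64)·Σ_P avgR(dw)(P)²` at L = 2. [folklore] -/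
theorem EFflat_two_eq (w : XX (2 * N) → Fin 2 → ℝ) :
    EFflat 2 (blkB 2 N) w = ∑ x, dF w x ^ 2 - (1 / 64) * ∑ P, avgR N (dF w) P ^ 2 := by
  unfold EFflat
  simp_rw [dcQ_two, mul_pow, ← mul_sum]
  ring

/-- **LENS 1's FLAT SHARP MASTER INEQUALITY, IN KERNEL ON EVERY EVEN TORUS**: for every 1-form `w` on `(ℤ∕2N)²`,
`⟨w, (½Hess² − ⅛Hess³)w⟩ ≤ EF^flat(w)` — «EF^flat ≥ ⅛Hess_f²(4 − Hess_f)» on ALL 1-forms (hence on phys), L = 2, Bałaban's cells. [folklore] -/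
theorem flat_master_oneforms (w : XX (2 * N) → Fin 2 → ℝ) : phiHessForm N w ≤ EFflat 2 (blkB 2 N) w := by
  rw [phiHessForm_eq, EFflat_two_eq]
  have h := master_real N (dF w)
  have e : ∑ x, dF w x * gKR N (dF w) x
      = ∑ x, dF w x ^ 2 - ∑ x, dF w x * ((1 / 2) * lapR N (dF w) x - (1 / 8) * lapR N (lapR N (dF w)) x) := by
    rw [← sum_sub_distrib]
    exact sum_congr rfl fun x _ => by unfold gKR; ring
  rw [e] at h
  linarith

end OneForms

/-! ### Bałaban's (48) on the torus: the linearised average (42) docks to `d_cQ` -/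

section LinearAverage

variable (N : ℕ) [NeZero N]


/-- `A(Γ_{y, y+r})` for `r ∈ {0,1}²`: the tree contour changes the SECOND coordinate first (B5 (1.7): the d-th coordinate first), then the first:
`[r₂]·w(y, e₁) + [r₁]·w(y + r₂e₁, e₀)`. [folklore] -/
def treeSum (w : XX (2 * N) → Fin 2 → ℝ) (y : XX (2 * N)) (r : Bool × Bool) : ℝ :=
  (if r.2 then w y 1 else 0) + (if r.1 then w (y + (if r.2 then e1 else 0)) 0 else 0)

/-- `A([z, z + 2e_μ]) = w(z, μ) + w(z + e_μ, μ)` — the straight contour of the coarse bond. [folklore] -/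
def straightSum (w : XX (2 * N) → Fin 2 → ℝ) (z : XX (2 * N)) (μ : Fin 2) : ℝ :=
  w z μ + w (z + (if μ = 0 then e0 else e1)) μ

/-- **the linearised average (42)** on the coarse bond from the block with corner `y` in direction `μ` (L = 2, d = 2):
`Q^{lin}w(y, μ) := ¼ Σ_{r∈{0,1}²} [A(Γ_{y,y+r}) + A([y+r, y+r+2e_μ]) − A(Γ_{y+2e_μ, y+2e_μ+r})]` — the last tree piece REVERSED as in (14). [folklore] -/
def Qlin (w : XX (2 * N) → Fin 2 → ℝ) (y : XX (2 * N)) (μ : Fin 2) : ℝ :=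
  (1 / 4) * ∑ r : Bool × Bool,
    (treeSum N w y r + straightSum N w (y + offB N r) μ - treeSum N w (y + (if μ = 0 then e0 + e0 else e1 + e1)) r)

omit [NeZero N] in
/-- normalisation `Q̂(0) = L`: on a constant 1-form `Q^{lin}` returns `2·c`. [folklore] -/
theorem Qlin_const (c : ℝ) (y : XX (2 * N)) (μ : Fin 2) : Qlin N (fun _ _ => c) y μ = 2 * c := by
  unfold Qlin treeSum straightSum
  rw [Fintype.sum_prod_type]
  simp only [Fintype.sum_bool]
  split_ifs <;> ring

/-- **the coarse curl of the averaged field** around the big plaquette with corner `y`: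
`d_c(Q^{lin}w)(y) = Q(y, 0) + Q(y + 2e₀, 1) − Q(y + 2e₁, 0) − Q(y, 1)`. [folklore] -/
def dcQlin (w : XX (2 * N) → Fin 2 → ℝ) (y : XX (2 * N)) : ℝ :=
  Qlin N w y 0 + Qlin N w (y + (e0 + e0)) 1 - Qlin N w (y + (e1 + e1)) 0 - Qlin N w y 1


omit [NeZero N] in
/-- **(48) ON THE TORUS**: for every 1-form `w` and EVERY base point `y`,
`d_c(Q^{lin}w)(y) = ¼·Σ_{r∈{0,1}²} Σ_{v∈{0,1}²} (dw)(y + r + v)` — the tree parts cancel around the corners, the straight parts telescope into the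
boundary of the translated big plaquettes, and Stokes turns each boundary into its four fine curls. [folklore] -/
theorem dcQlin_eq (w : XX (2 * N) → Fin 2 → ℝ) (y : XX (2 * N)) :
    dcQlin N w y = (1 / 4) * ∑ r : Bool × Bool, ∑ v : Bool × Bool, dF w (y + offB N r + offB N v) := by
  unfold dcQlin Qlin treeSum straightSum dF offB
  rw [(ev_eq N).1, (ev_eq N).2]
  simp only [Fintype.sum_prod_type, Fintype.sum_bool, Bool.false_eq_true, show (1 : Fin 2) ≠ 0 from one_ne_zero, ↓reduceIte]
  simp only [e0, e1, Prod.mk_add_mk, add_assoc, add_zero, zero_add, Prod.mk_zero_zero]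
  norm_num
  ring

/-- **docking**: at a block corner the linearised average's coarse curl IS file 122's `d_cQ` (which was DEFINED by the right side of (48)). [folklore] -/
theorem dcQlin_corner (w : XX (2 * N) → Fin 2 → ℝ) (P : Fin N × Fin N) : dcQlin N w (corner N P) = dcQ 2 (blkB 2 N) (dF w) P := by
  rw [dcQlin_eq, dcQ_two]; rfl

/-- **lens 1's `EF := Hess_f − ¼Q†Hess_cQ` LITERALLY**: `EF^flat(w) = Σ_x |(dw)(x)|² − ¼·Σ_P (d_c(Q^{lin}w)(ιP))²` with Bałaban's linearised average. [folklore] -/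
theorem EFflat_eq_linear (w : XX (2 * N) → Fin 2 → ℝ) :
    EFflat 2 (blkB 2 N) w = ∑ x, dF w x ^ 2 - (1 / 4) * ∑ P, dcQlin N w (corner N P) ^ 2 := by
  unfold EFflat
  simp_rw [dcQlin_corner]
  norm_num

/-- **THE FLAT SHARP MASTER INEQUALITY ON BAŁABAN's LINEARISED AVERAGE**: for every 1-form `w` on `(ℤ∕2N)²`,
`⟨w, (½Hess² − ⅛Hess³)w⟩ ≤ Σ|dw|² − ¼Σ_P (d_c(Q^{lin}w)(ιP))²`. [folklore] -/
theorem flat_master_linear (w : XX (2 * N) → Fin 2 → ℝ) :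
    phiHessForm N w ≤ ∑ x, dF w x ^ 2 - (1 / 4) * ∑ P, dcQlin N w (corner N P) ^ 2 := by
  rw [← EFflat_eq_linear]; exact flat_master_oneforms N w

end LinearAverage

end Summit.QuantumFields.BalabanUV.T4Continuum.NE7EJFlatBloch

end
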